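import Mathlib
import Literature.RepresentationTheory.Semisimple.BrauerNesbitt
import Literature.RepresentationTheory.Semisimple.CharpolySubquotient
import HarnessLib

/-!
# Route `PhantomRMYoshida`, crux `StableYoshidaCongruence` (stmt-Langlands-13640), line
# `serre-dual-ribet-square`: Stub 3a, part BN — no lines and no co-lines under the characteristic
# polynomials of `σ₁ ⊕ σ₂`

Helper for the lead's stub `stub_invariantSubspaceFinrankTwo` (3a: every non-trivial proper invariant
subspace of a residually `2 + 2` representation is a plane).  This file is the finite-group-theoretic
heart, with no Galois theory and no topology: let `τ` be a representation of a group `G` on a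
finite-dimensional `k`-space `V` whose characteristic polynomials are those of `σ₁ ⊕ σ₂`,
`det(X - τ(g)) = det(X - σ₁(g)) · det(X - σ₂(g))` for all `g`, with `σ₁, σ₂` IRREDUCIBLE of dimensions
`≠ 1`.  Then no `τ`-stable subspace `W ⊆ V` has dimension `1` or codimension `1`
(`finrank_ne_one_of_charpoly_eq_mul`).

Proof (Curtis–Reiner (30.16); Serre, *Abelian ℓ-adic representations* I §2.3; Bourbaki A VIII § 20
n° 6): a stable line `W` is a simple `k[G]`-module `S`; with a semisimplification `M'` of `V/W`
(`Module.exists_isSemisimpleModule_charpoly_smul_eq`, Bourbaki's "semi-simplifié") the semisimple module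
`S × M'` has the characteristic polynomials of `σ₁.asModule × σ₂.asModule` (multiplicativity of `χ` along
`0 → W → V → V/W → 0`, `LinearMap.charpoly_eq_charpoly_restrict_mul_charpoly_mapQ`), so the key step of
the characteristic-free Brauer–Nesbitt theorem (`Module.exists_linearMap_ne_zero_of_charpoly_smul_of_eq`)
maps `S × 0` non-trivially, hence (Schur) isomorphically, onto `σ₁` or `σ₂` — contradicting the
dimensions.  The co-line case is the same with `V/W` simple and `W` semisimplified.  Everything used is
proved in the tree (`Literature/RepresentationTheory/Semisimple/{BrauerNesbitt,CharpolySubquotient}`).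
-/

-- `Summit.Langlands.Langlands.…` (summit = sub-problem name, D-0017 layout) trips `dupNamespace` on every decl.
set_option linter.dupNamespace false

noncomputable section

open Module Polynomial
open scoped MonoidAlgebra
open Literature.RepresentationTheory.Semisimple

namespace Summit.Langlands.Langlands.Cruxes.StableYoshidaCongruence.SerreDualRibetSquare

universe u v

variable {k : Type u} [Field k] {G : Type v} [Group G]

/-- A binary product of semisimple modules is semisimple (Mathlib has the `Π`/`→₀` instances only; the
product is the sup of the two semisimple ranges of `inl`, `inr`). [folklore] -/
theorem isSemisimpleModule_prod {R : Type*} [Ring R] {M N : Type*} [AddCommGroup M] [Module R M]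
    [AddCommGroup N] [Module R N] [IsSemisimpleModule R M] [IsSemisimpleModule R N] :
    IsSemisimpleModule R (M × N) := by
  have h1 : IsSemisimpleModule R (LinearMap.range (LinearMap.inl R M N)) :=
    .of_surjective _ (LinearMap.inl R M N).surjective_rangeRestrict
  have h2 : IsSemisimpleModule R (LinearMap.range (LinearMap.inr R M N)) :=
    .of_surjective _ (LinearMap.inr R M N).surjective_rangeRestrict
  have h := IsSemisimpleModule.sup h1 h2
  rw [LinearMap.sup_range_inl_inr] at h
  exact .congr (Submodule.topEquiv).symm

/-- A module over a `k`-algebra `R` which is a line over `k` is a simple `R`-module (its `R`-submodules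
are `k`-subspaces of a line). [folklore] -/
theorem isSimpleModule_of_finrank_eq_one {R : Type*} [Ring R] [Algebra k R] {M : Type*}
    [AddCommGroup M] [Module k M] [Module R M] [IsScalarTower k R M] (h : finrank k M = 1) :
    IsSimpleModule R M := by
  haveI : IsSimpleModule k M := isSimpleModule_iff_finrank_eq_one.mpr h
  haveI : Nontrivial M := IsSimpleModule.nontrivial k M
  refine (isSimpleModule_iff R M).mpr ⟨fun N => ?_⟩
  rcases eq_bot_or_eq_top (N.restrictScalars k) with hN | hN
  · exact Or.inl ((Submodule.restrictScalars_eq_bot_iff _ _ _).mp hN)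
  · exact Or.inr ((Submodule.restrictScalars_eq_top_iff _ _ _).mp hN)

/-- **Core of the Brauer–Nesbitt step.**  Let `S` be a simple and `M'` a semisimple `k[G]`-module, `N₁`,
`N₂` simple `k[G]`-modules, all finite-dimensional over `k`, such that every `g ∈ G` has the same
characteristic polynomial on `S × M'` and on `N₁ × N₂`.  Then `dim_k S ∈ {dim_k N₁, dim_k N₂}`: by the
key step of the characteristic-free Brauer–Nesbitt theorem
(`Module.exists_linearMap_ne_zero_of_charpoly_smul_of_eq`, Bourbaki A VIII § 20 n° 6) the simple
submodule `S × 0` maps non-trivially to `N₁ × N₂`, hence isomorphically onto `N₁` or `N₂` (Schur,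
`LinearMap.bijective_or_eq_zero`). [cite: CurtisReiner1962, (30.16)] -/
theorem finrank_eq_or_eq_of_charpoly_smul_prod_eq {S : Type*} {M' : Type*} {N₁ : Type*} {N₂ : Type*}
    [AddCommGroup S] [Module k S] [Module k[G] S] [IsScalarTower k k[G] S] [FiniteDimensional k S]
    [IsSimpleModule k[G] S]
    [AddCommGroup M'] [Module k M'] [Module k[G] M'] [IsScalarTower k k[G] M'] [FiniteDimensional k M']
    [IsSemisimpleModule k[G] M']
    [AddCommGroup N₁] [Module k N₁] [Module k[G] N₁] [IsScalarTower k k[G] N₁] [FiniteDimensional k N₁]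
    [IsSimpleModule k[G] N₁]
    [AddCommGroup N₂] [Module k N₂] [Module k[G] N₂] [IsScalarTower k k[G] N₂] [FiniteDimensional k N₂]
    [IsSimpleModule k[G] N₂]
    (h : ∀ g : G, (DistribSMul.toLinearMap k (S × M') (MonoidAlgebra.of k G g)).charpoly =
      (DistribSMul.toLinearMap k (N₁ × N₂) (MonoidAlgebra.of k G g)).charpoly) :
    finrank k S = finrank k N₁ ∨ finrank k S = finrank k N₂ := by
  haveI : IsSemisimpleModule k[G] (S × M') := isSemisimpleModule_prod
  haveI : IsSemisimpleModule k[G] (N₁ × N₂) := isSemisimpleModule_prod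
  -- the simple submodule `S × 0`
  set S' : Submodule k[G] (S × M') := LinearMap.range (LinearMap.inl k[G] S M') with hS'
  let e : S ≃ₗ[k[G]] S' := LinearEquiv.ofInjective (LinearMap.inl k[G] S M') LinearMap.inl_injective
  haveI : IsSimpleModule k[G] S' := IsSimpleModule.congr e.symm
  obtain ⟨f, hf⟩ := Module.exists_linearMap_ne_zero_of_charpoly_smul_of_eq (k := k) (G := G) h S'
  -- its two components, through `S ≃ S × 0`
  set f₁ : S →ₗ[k[G]] N₁ := LinearMap.fst k[G] N₁ N₂ ∘ₗ f ∘ₗ e.toLinearMap with hf₁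
  set f₂ : S →ₗ[k[G]] N₂ := LinearMap.snd k[G] N₁ N₂ ∘ₗ f ∘ₗ e.toLinearMap with hf₂
  by_contra hcon
  rw [not_or] at hcon
  have h₁ : f₁ = 0 := by
    refine (LinearMap.bijective_or_eq_zero f₁).resolve_left fun hb => hcon.1 ?_
    exact (LinearEquiv.ofBijective (f₁.restrictScalars k) hb).finrank_eq
  have h₂ : f₂ = 0 := by
    refine (LinearMap.bijective_or_eq_zero f₂).resolve_left fun hb => hcon.2 ?_
    exact (LinearEquiv.ofBijective (f₂.restrictScalars k) hb).finrank_eq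
  apply hf
  refine LinearMap.ext fun x => ?_
  obtain ⟨s, rfl⟩ := e.surjective x
  have e1 : f (e s) = (f₁ s, f₂ s) := Prod.ext rfl rfl
  rw [LinearMap.zero_apply, e1, h₁, h₂, LinearMap.zero_apply, LinearMap.zero_apply, Prod.mk_zero_zero]

/-- The characteristic polynomial of `g` on the `k[G]`-module of a representation `ρ` is that of `ρ g`
(`Representation.charpoly_smul_asModule`, `Representation.asAlgebraHom_of`). [folklore] -/
theorem charpoly_smul_asModule_of {V : Type*} [AddCommGroup V] [Module k V] [FiniteDimensional k V]
    (ρ : Representation k G V) (g : G) :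
    (DistribSMul.toLinearMap k ρ.asModule (MonoidAlgebra.of k G g)).charpoly = (ρ g).charpoly := by
  rw [Representation.charpoly_smul_asModule, Representation.asAlgebraHom_of]

/-- **No lines and no co-lines in a representation with the characteristic polynomials of `σ₁ ⊕ σ₂`,
`σ₁, σ₂` irreducible of dimension `≠ 1`** (Jordan–Hölder / Brauer–Nesbitt; Curtis–Reiner (30.16), Serre,
*Abelian ℓ-adic representations* I §2.3).  Let `τ` be a representation of a group `G` on a
finite-dimensional `k`-space `V` with `det(X - τ(g)) = det(X - σ₁(g)) · det(X - σ₂(g))` for all `g`, where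
`σ₁, σ₂` are irreducible representations of `G` of dimensions `≠ 1`.  Then no `τ`-stable subspace `W`
has dimension `1` or codimension `1`: otherwise the line `W` (resp. `V/W`) together with a
semisimplification of `V/W` (resp. `W`) is a semisimple `k[G]`-module with the characteristic
polynomials of `σ₁ ⊕ σ₂` (`χ` is multiplicative along `0 → W → V → V/W → 0`), and the key step of
Brauer–Nesbitt embeds the line into `σ₁` or `σ₂` (`finrank_eq_or_eq_of_charpoly_smul_prod_eq`) —
absurd.  In particular the Jordan–Hölder constituents of `τ` have the dimensions of `σ₁, σ₂`.
[cite: CurtisReiner1962, (30.16); SerreAbelianLadic1968, Ch. I §2.3] -/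
theorem finrank_ne_one_of_charpoly_eq_mul :
    ∀ {k : Type*} [Field k] {G : Type*} [Group G] {V X₁ X₂ : Type*}
      [AddCommGroup V] [Module k V] [FiniteDimensional k V]
      [AddCommGroup X₁] [Module k X₁] [FiniteDimensional k X₁]
      [AddCommGroup X₂] [Module k X₂] [FiniteDimensional k X₂]
      (τ : Representation k G V) (σ₁ : Representation k G X₁) (σ₂ : Representation k G X₂),
      σ₁.IsIrreducible → σ₂.IsIrreducible → Module.finrank k X₁ ≠ 1 → Module.finrank k X₂ ≠ 1 →
      (∀ g, (τ g).charpoly = (σ₁ g).charpoly * (σ₂ g).charpoly) →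
      ∀ W : Submodule k V, (∀ g, W ≤ W.comap (τ g)) →
        Module.finrank k W ≠ 1 ∧ Module.finrank k (V ⧸ W) ≠ 1 := by
  intro k _ G _ V X₁ X₂ _ _ _ _ _ _ _ _ _ τ σ₁ σ₂ hσ₁ hσ₂ h₁ h₂ h W hW
  classical
  -- sub and quotient, `χ_V = χ_W · χ_{V/W}`
  set τW : Representation k G W := τ.subrepresentation W hW with hτW
  set τQ : Representation k G (V ⧸ W) := τ.quotient W hW with hτQ
  have hmul : ∀ g, (τ g).charpoly = (τW g).charpoly * (τQ g).charpoly := fun g =>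
    LinearMap.charpoly_eq_charpoly_restrict_mul_charpoly_mapQ (τ g) W (hW g)
  -- the `k[G]`-modules of `σ₁`, `σ₂`
  haveI : IsSimpleModule k[G] σ₁.asModule :=
    (Representation.irreducible_iff_isSimpleModule_asModule σ₁).mp hσ₁
  haveI : IsSimpleModule k[G] σ₂.asModule :=
    (Representation.irreducible_iff_isSimpleModule_asModule σ₂).mp hσ₂
  have hN : ∀ g, (DistribSMul.toLinearMap k (σ₁.asModule × σ₂.asModule) (MonoidAlgebra.of k G g)).charpoly
      = (σ₁ g).charpoly * (σ₂ g).charpoly := fun g => by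
    rw [Module.charpoly_smul_prod, charpoly_smul_asModule_of, charpoly_smul_asModule_of]
  have hX₁ : finrank k σ₁.asModule = finrank k X₁ := rfl
  have hX₂ : finrank k σ₂.asModule = finrank k X₂ := rfl
  refine ⟨fun hW1 => ?_, fun hQ1 => ?_⟩
  · -- a stable line
    have hW1' : finrank k τW.asModule = 1 := hW1
    haveI : IsSimpleModule k[G] τW.asModule := isSimpleModule_of_finrank_eq_one (k := k) hW1'
    obtain ⟨M', _, _, _, _, _, _, hM'⟩ :=
      Module.exists_isSemisimpleModule_charpoly_smul_eq (k := k) (R := k[G]) τQ.asModule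
    have hM : ∀ g, (DistribSMul.toLinearMap k (τW.asModule × M') (MonoidAlgebra.of k G g)).charpoly =
        (DistribSMul.toLinearMap k (σ₁.asModule × σ₂.asModule) (MonoidAlgebra.of k G g)).charpoly := by
      intro g
      rw [Module.charpoly_smul_prod, hM', charpoly_smul_asModule_of, charpoly_smul_asModule_of, ← hmul,
        hN, h]
    rcases finrank_eq_or_eq_of_charpoly_smul_prod_eq (k := k) (G := G) hM with h1 | h2
    · exact h₁ (hX₁ ▸ h1 ▸ hW1.symm).symm
    · exact h₂ (hX₂ ▸ h2 ▸ hW1.symm).symm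
  · -- a stable hyperplane
    have hQ1' : finrank k τQ.asModule = 1 := hQ1
    haveI : IsSimpleModule k[G] τQ.asModule := isSimpleModule_of_finrank_eq_one (k := k) hQ1'
    obtain ⟨M', _, _, _, _, _, _, hM'⟩ :=
      Module.exists_isSemisimpleModule_charpoly_smul_eq (k := k) (R := k[G]) τW.asModule
    have hM : ∀ g, (DistribSMul.toLinearMap k (τQ.asModule × M') (MonoidAlgebra.of k G g)).charpoly =
        (DistribSMul.toLinearMap k (σ₁.asModule × σ₂.asModule) (MonoidAlgebra.of k G g)).charpoly := by
      intro g
      rw [Module.charpoly_smul_prod, hM', charpoly_smul_asModule_of, charpoly_smul_asModule_of, mul_comm,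
        ← hmul, hN, h]
    rcases finrank_eq_or_eq_of_charpoly_smul_prod_eq (k := k) (G := G) hM with h1 | h2
    · exact h₁ (hX₁ ▸ h1 ▸ hQ1.symm).symm
    · exact h₂ (hX₂ ▸ h2 ▸ hQ1.symm).symm

end Summit.Langlands.Langlands.Cruxes.StableYoshidaCongruence.SerreDualRibetSquare

end
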